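import Mathlib.Analysis.Real.Pi.Bounds
import Mathlib.Analysis.SpecialFunctions.Trigonometric.Bounds
import HarnessLib

/-!
# Crux `MesoscopicPairOrder` (stmt-HubbardSuperconductivity-7331), Negative side:
# the real arithmetic of one `δ`-piece of the Stoner box (diamond parameter, sine floor, concave minimum)

Line `redirect_birth` (lead c11), Negative programme E1; companion of `StonerCouplingLeElevenHalves.lean`, which
evaluates the Stoner ceiling `2μn - L²·Hc + 8((L/π) sin((2h+1)π/L) + 2(L/π)² sin²(hπ/L)) - 8(n - |D_h|) - U n²/L²
≤ (μ + 4)(n - S)` (quartic hinge majorant + diamond paired sea) piece by piece in `δ`. Everything model-free is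
proved here once:

* `exists_diamond_param` — the largest diamond `|D_h| = 2h² + 2h + 1 ≤ n < |D_{h+1}|`;
* `pi_lt_frac_and_sq` (`π < 3141593/10⁶`, `π² < 98697/10⁴`), `sin_pi_mul_ge_of_ge` (`sin(πs) ≥ 1 - (πτ)²/2` on
  `[1/2 - τ, 1/2]`), `sine_floor_of_diamond` (`h/L ≥ a/2 - 1/10000` for the largest diamond when `a² ≤ 2ν_lo`,
  `L ≥ 20000`), `diamond_term_floor` (`L² cs²/(98697/10⁴) ≤ (L/π)² sn²`);
* `concave_quad_min_le`, `endpoint_value_lo`, `endpoint_value_hi` — the concave `n ↦ 2μn - (U/L²)n²` over the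
  filling window is smallest at an endpoint, and the endpoint values against the piece constants;
* `deficiency_piece_arith` — given the ceiling, the window `ν_lo L² - 1 ≤ n ≤ ν_hi L²` and the two MASTER
  INEQUALITIES `(μ+4)κ₀ + 1/500 ≤ 2μν - U_max ν² - Hc + 16cs²/(98697/10⁴)` (`ν = ν_lo, ν_hi`): `κ₀ L² ≤ n - S`;
* `filling_bounds_piece` — `n = ⌊(1-δ)L²/2⌋` in real terms on a piece `[d_lo, d_hi] ⊆ [1/10, 1/2]`;
* `sinPiMulGeOfGe` — registered sub-goal form of `sin_pi_mul_ge_of_ge`.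
Sources: folklore real analysis (`Real.pi_lt_d6`, `Real.one_sub_sq_div_two_le_cos`). No definition, no named fact,
no sorry.
-/

noncomputable section

-- the summit namespace repeats the problem name by design (D-0017)
set_option linter.dupNamespace false

namespace Summit.HubbardSuperconductivity.HubbardSuperconductivity.Theorems.MesoscopicPairOrder.Negative

section PieceArith

/-! ### The diamond parameter, the sine floor, the piece arithmetic -/

/-- The largest diamond inside the Fermi area: for `1 ≤ n` there is `h` with `2h² + 2h + 1 ≤ n < 2h² + 6h + 5`
(`= 2(h+1)² + 2(h+1) + 1`). [folklore] -/
theorem exists_diamond_param {n : ℕ} (hn : 1 ≤ n) :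
    ∃ h : ℕ, 2 * h ^ 2 + 2 * h + 1 ≤ n ∧ n < 2 * h ^ 2 + 6 * h + 5 := by
  classical
  have hex : ∃ h : ℕ, n < 2 * h ^ 2 + 6 * h + 5 := ⟨n, by nlinarith⟩
  refine ⟨Nat.find hex, ?_, Nat.find_spec hex⟩
  rcases Nat.eq_zero_or_pos (Nat.find hex) with h0 | hpos
  · rw [h0]; simpa using hn
  · have hmin := Nat.find_min hex (m := Nat.find hex - 1) (by omega)
    push Not at hmin
    obtain ⟨k, hk⟩ : ∃ k, Nat.find hex = k + 1 := ⟨Nat.find hex - 1, by omega⟩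
    rw [hk] at hmin ⊢
    have e : 2 * (k + 1 - 1) ^ 2 + 6 * (k + 1 - 1) + 5 = 2 * (k + 1) ^ 2 + 2 * (k + 1) + 1 := by
      rw [Nat.add_sub_cancel]; ring
    omega

/-- `π < 3141593/10⁶` and `π² < 98697/10⁴` in fraction form (`Real.pi_lt_d6`). [folklore] -/
theorem pi_lt_frac_and_sq : Real.pi < 3141593 / 1000000 ∧ Real.pi ^ 2 < 98697 / 10000 := by
  have hπ := Real.pi_pos
  have hπ3 : Real.pi < 3141593 / 1000000 := by
    have := Real.pi_lt_d6; norm_num at this ⊢; linarith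
  refine ⟨hπ3, ?_⟩
  have h2 : Real.pi ^ 2 < (3141593 / 1000000) ^ 2 := pow_lt_pow_left₀ hπ3 hπ.le (by norm_num)
  have h3 : ((3141593 : ℝ) / 1000000) ^ 2 < 98697 / 10000 := by norm_num
  linarith

/-- **`sin(π s) ≥ 1 - ((3141593/10⁶) τ)²/2` for `1/2 - τ ≤ s ≤ 1/2`, `0 ≤ τ ≤ 1/2`** (`sin(πs) = cos(π/2 - πs)`,
`cos` decreasing on `[0, π]`, `cos y ≥ 1 - y²/2`; mirror of `sin_pi_mul_ge_of_le`). [folklore] -/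
theorem sin_pi_mul_ge_of_ge {s τ : ℝ} (hs1 : 1 / 2 - τ ≤ s) (hs2 : s ≤ 1 / 2) (hτ0 : 0 ≤ τ) (hτ1 : τ ≤ 1 / 2) :
    1 - (3141593 / 1000000 * τ) ^ 2 / 2 ≤ Real.sin (Real.pi * s) := by
  have hπ := Real.pi_pos
  have hπ3 := pi_lt_frac_and_sq.1
  rw [← Real.cos_pi_div_two_sub]
  have hx0 : 0 ≤ Real.pi / 2 - Real.pi * s := by nlinarith
  have hxy : Real.pi / 2 - Real.pi * s ≤ Real.pi * τ := by nlinarith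
  have hyπ : Real.pi * τ ≤ Real.pi := by nlinarith
  have h1 : Real.cos (Real.pi * τ) ≤ Real.cos (Real.pi / 2 - Real.pi * s) :=
    Real.cos_le_cos_of_nonneg_of_le_pi hx0 hyπ hxy
  have h2 : 1 - (Real.pi * τ) ^ 2 / 2 ≤ Real.cos (Real.pi * τ) := Real.one_sub_sq_div_two_le_cos
  have h3 : (Real.pi * τ) ^ 2 ≤ (3141593 / 1000000 * τ) ^ 2 :=
    pow_le_pow_left₀ (by positivity) (by nlinarith) 2
  linarith

/-- **The sine floor of the diamond.** If `(2h + 3)² > 2ν_lo L² - 3` (largest diamond, `n ≥ ν_lo L² - 1`),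
`h ≤ L/2`, `a² ≤ 2ν_lo`, `4/5 ≤ a ≤ 1`, `L ≥ 20000`, then `h/L ∈ [a/2 - 1/10000, 1/2]` and
`sin(hπ/L) ≥ 1 - ((3141593/10⁶)(1/2 - a/2 + 1/10000))²/2`. [folklore] -/
theorem sine_floor_of_diamond {L h νlo a : ℝ} (hL : 20000 ≤ L) (hh0 : 0 ≤ h)
    (hbig : 2 * νlo * L ^ 2 - 3 < (2 * h + 3) ^ 2) (hhL : h ≤ L / 2)
    (ha2 : a ^ 2 ≤ 2 * νlo) (ha0 : 4 / 5 ≤ a) (ha1 : a ≤ 1) :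
    1 - (3141593 / 1000000 * (1 / 2 - a / 2 + 1 / 10000)) ^ 2 / 2 ≤ Real.sin (h * Real.pi / L) := by
  have hLpos : 0 < L := by linarith
  -- `(aL - 1)² ≤ 2 νlo L² - 3 < (2h+3)²`, hence `aL - 1 < 2h + 3`
  have haL : 2 ≤ a * L := by nlinarith
  have h1 : (a * L - 1) ^ 2 ≤ 2 * νlo * L ^ 2 - 3 := by
    have : a ^ 2 * L ^ 2 ≤ 2 * νlo * L ^ 2 := mul_le_mul_of_nonneg_right ha2 (sq_nonneg L)
    nlinarith
  have h2 : a * L - 1 < 2 * h + 3 := by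
    have hlt : (a * L - 1) ^ 2 < (2 * h + 3) ^ 2 := lt_of_le_of_lt h1 hbig
    exact lt_of_pow_lt_pow_left₀ 2 (by positivity) hlt
  have e_arg : h * Real.pi / L = Real.pi * (h / L) := by field_simp
  rw [e_arg]
  apply sin_pi_mul_ge_of_ge
  · rw [le_div_iff₀ hLpos]
    have : 2 ≤ (1 : ℝ) / 10000 * L := by linarith
    nlinarith
  · rw [div_le_iff₀ hLpos]; linarith
  · linarith
  · linarith

/-- The diamond term against `π² < 98697/10⁴`: `L² cs²/(98697/10⁴) ≤ (L/π)² sn²` for `0 ≤ cs ≤ sn`. [folklore] -/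
theorem diamond_term_floor {L cs sn : ℝ} (hcs : 0 ≤ cs) (hsn : cs ≤ sn) :
    L ^ 2 * cs ^ 2 / (98697 / 10000) ≤ (L / Real.pi) ^ 2 * sn ^ 2 := by
  have hπ := Real.pi_pos
  have hπ2 := pi_lt_frac_and_sq.2
  have hcs2 : cs ^ 2 ≤ sn ^ 2 := pow_le_pow_left₀ hcs hsn 2
  have hA : (L / Real.pi) ^ 2 * cs ^ 2 ≤ (L / Real.pi) ^ 2 * sn ^ 2 :=
    mul_le_mul_of_nonneg_left hcs2 (sq_nonneg _)
  have hB : L ^ 2 * cs ^ 2 / (98697 / 10000) ≤ L ^ 2 * cs ^ 2 / Real.pi ^ 2 :=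
    div_le_div_of_nonneg_left (by positivity) (by positivity) hπ2.le
  have hC : L ^ 2 * cs ^ 2 / Real.pi ^ 2 = (L / Real.pi) ^ 2 * cs ^ 2 := by
    rw [div_pow]; ring
  linarith [hC.le, hC.ge]

/-- **Concave minimum at the endpoints**: for `0 ≤ w`, `a ≤ n ≤ b`,
`min(2μa - wa², 2μb - wb²) ≤ 2μn - wn²`. [folklore] -/
theorem concave_quad_min_le {w μ a b n : ℝ} (hw : 0 ≤ w) (han : a ≤ n) (hnb : n ≤ b) :
    min (2 * μ * a - w * a ^ 2) (2 * μ * b - w * b ^ 2) ≤ 2 * μ * n - w * n ^ 2 := by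
  by_cases hc : w * (n + a) ≤ 2 * μ
  · have hkey : 0 ≤ (n - a) * (2 * μ - w * (n + a)) := mul_nonneg (by linarith) (by linarith)
    have : 2 * μ * a - w * a ^ 2 ≤ 2 * μ * n - w * n ^ 2 := by nlinarith
    exact le_trans (min_le_left _ _) this
  · push Not at hc
    have hmono : w * (n + a) ≤ w * (n + b) := mul_le_mul_of_nonneg_left (by linarith) hw
    have hkey : 0 ≤ (b - n) * (w * (n + b) - 2 * μ) := mul_nonneg (by linarith) (by linarith)
    have : 2 * μ * b - w * b ^ 2 ≤ 2 * μ * n - w * n ^ 2 := by nlinarith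
    exact le_trans (min_le_right _ _) this

/-- The lower endpoint value: `(2μν_lo - U_max ν_lo²)L² - 2μ ≤ 2μ(ν_lo L² - 1) - w(ν_lo L² - 1)²` for
`w L² = U ≤ U_max`, `0 ≤ w`, `0 ≤ ν_lo L² - 1`. [folklore] -/
theorem endpoint_value_lo {U Umax w L μ νlo : ℝ} (hU : U ≤ Umax) (hw0 : 0 ≤ w) (hwL : w * L ^ 2 = U)
    (ha0 : 0 ≤ νlo * L ^ 2 - 1) (hL2 : 0 ≤ L ^ 2) :
    (2 * μ * νlo - Umax * νlo ^ 2) * L ^ 2 - 2 * μ ≤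
      2 * μ * (νlo * L ^ 2 - 1) - w * (νlo * L ^ 2 - 1) ^ 2 := by
  have h1 : (νlo * L ^ 2 - 1) ^ 2 ≤ (νlo * L ^ 2) ^ 2 := pow_le_pow_left₀ ha0 (by linarith) 2
  have h2 : w * (νlo * L ^ 2 - 1) ^ 2 ≤ w * (νlo * L ^ 2) ^ 2 := mul_le_mul_of_nonneg_left h1 hw0
  have h3 : w * (νlo * L ^ 2) ^ 2 = U * νlo ^ 2 * L ^ 2 := by
    rw [show w * (νlo * L ^ 2) ^ 2 = (w * L ^ 2) * (νlo ^ 2 * L ^ 2) by ring, hwL]; ring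
  have h4 : U * νlo ^ 2 * L ^ 2 ≤ Umax * νlo ^ 2 * L ^ 2 :=
    mul_le_mul_of_nonneg_right (mul_le_mul_of_nonneg_right hU (sq_nonneg _)) hL2
  have h5 : (2 * μ * νlo - Umax * νlo ^ 2) * L ^ 2 - 2 * μ =
      2 * μ * (νlo * L ^ 2 - 1) - Umax * νlo ^ 2 * L ^ 2 := by ring
  linarith

/-- The upper endpoint value: `(2μν - U_max ν²)L² ≤ 2μ(ν L²) - w(ν L²)²` for `w L² = U ≤ U_max`. [folklore] -/
theorem endpoint_value_hi {U Umax w L μ ν : ℝ} (hU : U ≤ Umax) (hwL : w * L ^ 2 = U) (hL2 : 0 ≤ L ^ 2) :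
    (2 * μ * ν - Umax * ν ^ 2) * L ^ 2 ≤ 2 * μ * (ν * L ^ 2) - w * (ν * L ^ 2) ^ 2 := by
  have h3 : w * (ν * L ^ 2) ^ 2 = U * ν ^ 2 * L ^ 2 := by
    rw [show w * (ν * L ^ 2) ^ 2 = (w * L ^ 2) * (ν ^ 2 * L ^ 2) by ring, hwL]; ring
  have h4 : U * ν ^ 2 * L ^ 2 ≤ Umax * ν ^ 2 * L ^ 2 :=
    mul_le_mul_of_nonneg_right (mul_le_mul_of_nonneg_right hU (sq_nonneg _)) hL2
  have h5 : (2 * μ * ν - Umax * ν ^ 2) * L ^ 2 = 2 * μ * (ν * L ^ 2) - Umax * ν ^ 2 * L ^ 2 := by ring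
  linarith

/-- **The arithmetic of one `δ`-piece.** With the Stoner ceiling `hstoner` (quartic hinge constant `Hc`, diamond
sine `sn ≥ cs ≥ 0`, surplus `sur ≤ 4L + 3`, `0 ≤ U ≤ U_max`), the filling window `ν_lo L² - 1 ≤ n ≤ ν_hi L²` and the
two MASTER INEQUALITIES `(μ+4)κ₀ + 1/500 ≤ 2μν - U_max ν² - Hc + 16 cs²/(98697/10⁴)` at `ν = ν_lo, ν_hi` (the
minimum of the concave `n ↦ 2μn - Un²/L²` over the window is at an endpoint; `π² < 9.8697`; `L ≥ 20000` absorbs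
the `O(L)` terms): `κ₀ L² ≤ n - S`. [folklore] -/
theorem deficiency_piece_arith {L n S U Umax μ Hc X sn sur κ₀ νlo νhi cs : ℝ}
    (hL : 20000 ≤ L) (hU0 : 0 ≤ U) (hU : U ≤ Umax)
    (hn_lo : νlo * L ^ 2 - 1 ≤ n) (hn_hi : n ≤ νhi * L ^ 2) (hνlo : 1 / 4 ≤ νlo)
    (hstoner : 2 * μ * n - L ^ 2 * Hc + 8 * (X + 2 * (L / Real.pi) ^ 2 * sn ^ 2) - 8 * sur - U * (n ^ 2 / L ^ 2) ≤
      (μ + 4) * (n - S))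
    (hX : 0 ≤ X) (hsn : cs ≤ sn) (hcs : 0 ≤ cs) (hsur : sur ≤ 4 * L + 3) (hμ0 : 0 ≤ μ) (hμ4 : μ ≤ 4)
    (hm_lo : (μ + 4) * κ₀ + 1 / 500 ≤ 2 * μ * νlo - Umax * νlo ^ 2 - Hc + 16 * cs ^ 2 / (98697 / 10000))
    (hm_hi : (μ + 4) * κ₀ + 1 / 500 ≤ 2 * μ * νhi - Umax * νhi ^ 2 - Hc + 16 * cs ^ 2 / (98697 / 10000)) :
    κ₀ * L ^ 2 ≤ n - S := by
  have hLpos : 0 < L := by linarith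
  have hL2 : 0 < L ^ 2 := by positivity
  have hL2' : (20000 : ℝ) * L ≤ L ^ 2 := by rw [sq]; exact mul_le_mul_of_nonneg_right hL hLpos.le
  -- the diamond term
  have hdia := diamond_term_floor (L := L) hcs hsn
  -- the concave quadratic `2μn - w n²`, `w = U/L²`
  set w := U / L ^ 2 with hw
  have hw0 : 0 ≤ w := div_nonneg hU0 hL2.le
  have hUn : U * (n ^ 2 / L ^ 2) = w * n ^ 2 := by rw [hw]; field_simp
  have hwL : w * L ^ 2 = U := by rw [hw]; field_simp
  have hmin := concave_quad_min_le (μ := μ) hw0 hn_lo hn_hi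
  -- the two endpoint values against the master cores
  have ha0 : 0 ≤ νlo * L ^ 2 - 1 := by
    have : (1 : ℝ) / 4 * (20000 * L) ≤ νlo * L ^ 2 := mul_le_mul hνlo hL2' (by positivity) (by linarith)
    linarith
  have hfa := endpoint_value_lo (μ := μ) hU hw0 hwL ha0 hL2.le
  have hfb := endpoint_value_hi (μ := μ) (ν := νhi) hU hwL hL2.le
  -- the smaller master core `m` satisfies `m L² - 2μ ≤ 2μn - w n²`
  have hlo' : ((μ + 4) * κ₀ + 1 / 500 + Hc - 16 * cs ^ 2 / (98697 / 10000)) * L ^ 2 ≤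
      (2 * μ * νlo - Umax * νlo ^ 2) * L ^ 2 := mul_le_mul_of_nonneg_right (by linarith) hL2.le
  have hhi' : ((μ + 4) * κ₀ + 1 / 500 + Hc - 16 * cs ^ 2 / (98697 / 10000)) * L ^ 2 ≤
      (2 * μ * νhi - Umax * νhi ^ 2) * L ^ 2 := mul_le_mul_of_nonneg_right (by linarith) hL2.le
  have hcore : ((μ + 4) * κ₀ + 1 / 500 + Hc - 16 * cs ^ 2 / (98697 / 10000)) * L ^ 2 - 2 * μ ≤
      2 * μ * n - w * n ^ 2 := by
    rcases min_cases (2 * μ * (νlo * L ^ 2 - 1) - w * (νlo * L ^ 2 - 1) ^ 2)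
      (2 * μ * (νhi * L ^ 2) - w * (νhi * L ^ 2) ^ 2) with ⟨hm, -⟩ | ⟨hm, -⟩
    · rw [hm] at hmin; linarith
    · rw [hm] at hmin; linarith
  -- assemble (everything is linear from here, after two ring identities fixing the atoms)
  rw [hUn] at hstoner
  have hexp : ((μ + 4) * κ₀ + 1 / 500 + Hc - 16 * cs ^ 2 / (98697 / 10000)) * L ^ 2 =
      (μ + 4) * (κ₀ * L ^ 2) + 1 / 500 * L ^ 2 + L ^ 2 * Hc - 16 * (L ^ 2 * cs ^ 2 / (98697 / 10000)) := by
    ring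
  have hexp2 : 8 * (X + 2 * (L / Real.pi) ^ 2 * sn ^ 2) = 8 * X + 16 * ((L / Real.pi) ^ 2 * sn ^ 2) := by ring
  have hexp3 : (μ + 4) * (n - S) = (μ + 4) * (κ₀ * L ^ 2) + (μ + 4) * (n - S - κ₀ * L ^ 2) := by ring
  rw [hexp2, hexp3] at hstoner
  rw [hexp] at hcore
  have hLL : 32 * L + 24 + 2 * μ ≤ 1 / 500 * L ^ 2 := by linarith
  have htot : 0 ≤ (μ + 4) * (n - S - κ₀ * L ^ 2) := by linarith
  have hμpos : 0 < μ + 4 := by linarith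
  have := (mul_nonneg_iff_of_pos_left hμpos).1 htot
  linarith

/-- The filling `n = ⌊(1-δ)L²/2⌋` on a `δ`-piece `[d_lo, d_hi]` in real terms: `ν_lo L² - 1 ≤ n ≤ ν_hi L²` with
`ν_lo = (1 - d_hi)/2`, `ν_hi = (1 - d_lo)/2`, and `1 ≤ n ≤ (9/20) L²`. [folklore] -/
theorem filling_bounds_piece {δ L n dlo dhi : ℝ} (hL : 20000 ≤ L) (hδ1 : dlo ≤ δ) (hδ2 : δ ≤ dhi)
    (hd0 : 1 / 10 ≤ dlo) (hd1 : dhi ≤ 1 / 2)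
    (hn_le : n ≤ (1 - δ) * L ^ 2 / 2) (hn_ge : (1 - δ) * L ^ 2 / 2 - 1 ≤ n) :
    (1 - dhi) / 2 * L ^ 2 - 1 ≤ n ∧ n ≤ (1 - dlo) / 2 * L ^ 2 ∧ 1 ≤ n ∧ n ≤ 9 / 20 * L ^ 2 := by
  have hL2 : (20000 : ℝ) * 20000 ≤ L ^ 2 := by nlinarith
  have hmul : ∀ {a b : ℝ}, a ≤ b → a * L ^ 2 ≤ b * L ^ 2 := fun h => mul_le_mul_of_nonneg_right h (sq_nonneg L)
  have h1 := hmul hδ1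
  have h2 := hmul hδ2
  have h3 := hmul hd1
  have h4 := hmul hd0
  refine ⟨by linarith, by linarith, by linarith, by linarith⟩


end PieceArith

/-- Registered sub-goal form (item stmt-HubbardSuperconductivity-7331, line `redirect_birth`, lead c11):
`sin(π s) ≥ 1 - ((3141593/10⁶) τ)²/2` for `s ∈ [1/2 - τ, 1/2]`, `τ ∈ [0, 1/2]`. [folklore] -/
theorem sinPiMulGeOfGe : ∀ {s τ : ℝ}, 1 / 2 - τ ≤ s → s ≤ 1 / 2 → 0 ≤ τ → τ ≤ 1 / 2 →
    1 - (3141593 / 1000000 * τ) ^ 2 / 2 ≤ Real.sin (Real.pi * s) :=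
  fun hs1 hs2 hτ0 hτ1 => sin_pi_mul_ge_of_ge hs1 hs2 hτ0 hτ1

end Summit.HubbardSuperconductivity.HubbardSuperconductivity.Theorems.MesoscopicPairOrder.Negative
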